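import Summits.Ventures.HodgeRepro2.T5SU11ResolventOfDecaySolution
import Summits.Ventures.HodgeRepro2.T5SU11KernelDifferenceRegularity

/-!
# The composed kernel at the corner: `K_λ^{∘2}(t, s) → ∫_0^∞ χ_λ(r)² sinh 2r dr` as `(t, s) → (0, 0)`

Unlike the kernel itself (row 603: `K_λ(t, t) → −∞`), the first composed kernel `K_λ^{∘2}(t, s) = ∫ K_λ(t, r) K_λ(r, s) sinh 2r dr`
is BOUNDED near the corner and extends continuously to `(0, 0)`: with the domination `|K_λ(t, r)| ≤ Φ χ_λ(r)` for `t ≤ 1` (row 643)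
and `χ_λ² sinh 2r ∈ L¹(0, ∞)` (row 643 with `λ₂ = λ`),

* `kernel_comp_two_eq_integral` — `K_λ^{∘2}(t, s) = ∫ K_λ(t, r) K_λ(r, s) sinh 2r dr`;
* `abs_kernel_comp_two_le_corner` — **`|K_λ^{∘2}(t, s)| ≤ Φ² ∫_0^∞ χ_λ² sinh 2r dr`** for `t, s ∈ (0, 1]`: the composed kernel is
  uniformly bounded on the corner square;
* `tendsto_kernel_comp_two_corner` — **`K_λ^{∘2}(t, s) → ∫_0^∞ χ_λ(r)² sinh 2r dr` as `(t, s) → (0⁺, 0⁺)`** (dominated convergence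
  along the product filter): the corner value is the `sinh`-mass of `χ_λ²`, positive.

Nothing is claimed about (N).

Blind lane: Mathlib + the HodgeRepro2 prefix only; no sorry; axioms ⊆ {propext, Classical.choice,
Quot.sound}.
-/

namespace Summit.Ventures.HodgeRepro2.T5SU11KernelCompositionCorner

open Filter Topology MeasureTheory
open Set (Ioi Ioc Icc)
open T5SU11Cartan T5SU11SphericalFunction T5SU11SphericalBounds T5SU11SphericalContinuous T5SU11SphericalDecay
  T5SU11ReductionOfOrder T5SU11RadialGreenKernel T5SU11RadialGreenImproper T5SU11RadialGreenImproperDecaySource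
  T5SU11ResolventKernelComposition T5SU11ResolventTransformClass T5SU11KernelEnds T5SU11KernelDifferenceRegularity
  T5SU11SphericalDecayFluxIdentity T5SU11ResolventOfDecaySolution T5SU11RadialGreenImproperOrigin

section measure

variable [MeasurableSpace Circle] [BorelSpace Circle]

variable {lam : ℝ} (hlam : 1 < lam)

include hlam in
/-- **`K_λ^{∘2}(t, s) = ∫_0^∞ K_λ(t, r) K_λ(r, s) sinh 2r dr`** for `t, s > 0` (the kernel representation on the class source
`K_λ(·, s)`, row 503). -/
theorem kernel_comp_two_eq_integral {t s : ℝ} (ht : 0 < t) (hs : 0 < s) :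
    ((greenSolI (fun t => sph lam (hyp t)) (sphDecay lam))^[1] (fun u => sphGreenKernel lam u s)) t
      = ∫ r in Ioi 0, sphGreenKernel lam t r * sphGreenKernel lam r s * Real.sinh (2 * r) := by
  obtain ⟨M, hM0, hM⟩ := kernel_source_bounded hlam hs
  obtain ⟨C, s₀, hC⟩ := kernel_source_decay hlam hs
  have hg := kernel_source_continuousOn hlam hs
  have hε : 2 - lam < lam := by linarith
  have hB := integrableOn_sph_mul_mul_sinh_Ioc hg hM hM0 lam
  have hA := integrableOn_sphDecay_mul_mul_sinh hlam hg hM hM0 hε hC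
  rw [Function.iterate_one, greenSolI_eq_integral_kernel hB hA ht]
  apply setIntegral_congr_fun measurableSet_Ioi
  intro r _
  simp only [sphGreenKernel]

include hlam in
/-- `K_λ(t, r) K_λ(r, s) sinh 2r` is integrable on `(0, ∞)` for `t, s > 0`. -/
theorem integrableOn_kernel_mul_kernel_mul_sinh {t s : ℝ} (ht : 0 < t) (hs : 0 < s) :
    IntegrableOn (fun r => sphGreenKernel lam t r * sphGreenKernel lam r s * Real.sinh (2 * r)) (Ioi 0) := by
  obtain ⟨M, hM0, hM⟩ := kernel_source_bounded hlam hs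
  obtain ⟨C, s₀, hC⟩ := kernel_source_decay hlam hs
  have hg := kernel_source_continuousOn hlam hs
  have hε : 2 - lam < lam := by linarith
  have hB := integrableOn_sph_mul_mul_sinh_Ioc hg hM hM0 lam
  have hA := integrableOn_sphDecay_mul_mul_sinh hlam hg hM hM0 hε hC
  have h := integrableOn_kernel_mul hB hA ht
  exact h

include hlam in
/-- **The composed kernel is uniformly bounded on the corner square**: `|K_λ^{∘2}(t, s)| ≤ Φ² ∫_0^∞ χ_λ² sinh 2r dr` for `t, s ∈ (0, 1]`,
where `φ_λ ≤ Φ` on `[0, 1]`. -/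
theorem abs_kernel_comp_two_le_corner {Φ : ℝ} (hΦ : ∀ u ∈ Icc (0 : ℝ) 1, sph lam (hyp u) ≤ Φ) (hΦ0 : 0 ≤ Φ)
    {t s : ℝ} (ht : 0 < t) (ht1 : t ≤ 1) (hs : 0 < s) (hs1 : s ≤ 1) :
    |((greenSolI (fun t => sph lam (hyp t)) (sphDecay lam))^[1] (fun u => sphGreenKernel lam u s)) t|
      ≤ Φ ^ 2 * ∫ r in Ioi 0, sphDecay lam r * sphDecay lam r * Real.sinh (2 * r) := by
  rw [kernel_comp_two_eq_integral hlam ht hs]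
  have hint := integrableOn_kernel_mul_kernel_mul_sinh hlam ht hs
  have hχχ := integrableOn_sphDecay_mul_sphDecay_mul_sinh hlam hlam
  calc |∫ r in Ioi 0, sphGreenKernel lam t r * sphGreenKernel lam r s * Real.sinh (2 * r)|
      ≤ ∫ r in Ioi 0, |sphGreenKernel lam t r * sphGreenKernel lam r s * Real.sinh (2 * r)| := abs_integral_le_integral_abs
    _ ≤ ∫ r in Ioi 0, Φ ^ 2 * (sphDecay lam r * sphDecay lam r * Real.sinh (2 * r)) := by
        refine setIntegral_mono_on hint.abs (hχχ.const_mul _) measurableSet_Ioi fun r hr => ?_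
        have hr' : (0 : ℝ) < r := hr
        have h1 := abs_kernel_le_mul_sphDecay_of_le_one hlam hΦ ht ht1 hr'
        have h2 : |sphGreenKernel lam r s| ≤ Φ * sphDecay lam r := by
          rw [sphGreenKernel_symm]
          exact abs_kernel_le_mul_sphDecay_of_le_one hlam hΦ hs hs1 hr'
        have hsh : 0 ≤ Real.sinh (2 * r) := (sinh_two_mul_pos hr').le
        rw [abs_mul, abs_mul, abs_of_nonneg hsh]
        have hχ : 0 ≤ sphDecay lam r := (sphDecay_pos hlam hr').le
        have hΦχ : 0 ≤ Φ * sphDecay lam r := mul_nonneg hΦ0 hχ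
        calc |sphGreenKernel lam t r| * |sphGreenKernel lam r s| * Real.sinh (2 * r)
            ≤ (Φ * sphDecay lam r) * (Φ * sphDecay lam r) * Real.sinh (2 * r) :=
              mul_le_mul_of_nonneg_right (mul_le_mul h1 h2 (abs_nonneg _) hΦχ) hsh
          _ = Φ ^ 2 * (sphDecay lam r * sphDecay lam r * Real.sinh (2 * r)) := by ring
    _ = Φ ^ 2 * ∫ r in Ioi 0, sphDecay lam r * sphDecay lam r * Real.sinh (2 * r) := by
        rw [MeasureTheory.integral_const_mul]

include hlam in
/-- **THE COMPOSED KERNEL AT THE CORNER**: `K_λ^{∘2}(t, s) → ∫_0^∞ χ_λ(r)² sinh 2r dr` as `(t, s) → (0⁺, 0⁺)`. -/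
theorem tendsto_kernel_comp_two_corner :
    Tendsto (fun p : ℝ × ℝ => ∫ r in Ioi 0, sphGreenKernel lam p.1 r * sphGreenKernel lam r p.2 * Real.sinh (2 * r))
      (𝓝[>] 0 ×ˢ 𝓝[>] 0) (𝓝 (∫ r in Ioi 0, sphDecay lam r * sphDecay lam r * Real.sinh (2 * r))) := by
  obtain ⟨Φ, hΦ0, hΦ⟩ := exists_sph_hyp_le lam
  have hχχ := integrableOn_sphDecay_mul_sphDecay_mul_sinh hlam hlam
  have hbound : Integrable (fun r => Φ ^ 2 * (sphDecay lam r * sphDecay lam r * Real.sinh (2 * r)))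
      (volume.restrict (Ioi 0)) := hχχ.const_mul _
  have hsq : ∀ᶠ p : ℝ × ℝ in 𝓝[>] 0 ×ˢ 𝓝[>] 0, 0 < p.1 ∧ p.1 ≤ 1 ∧ 0 < p.2 ∧ p.2 ≤ 1 := by
    filter_upwards [Filter.prod_mem_prod (Ioc_mem_nhdsGT one_pos) (Ioc_mem_nhdsGT one_pos)] with p hp
    exact ⟨hp.1.1, hp.1.2, hp.2.1, hp.2.2⟩
  have hmeas : ∀ᶠ p : ℝ × ℝ in 𝓝[>] 0 ×ˢ 𝓝[>] 0, AEStronglyMeasurable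
      (fun r => sphGreenKernel lam p.1 r * sphGreenKernel lam r p.2 * Real.sinh (2 * r)) (volume.restrict (Ioi 0)) := by
    filter_upwards [hsq] with p hp
    exact (integrableOn_kernel_mul_kernel_mul_sinh hlam hp.1 hp.2.2.1).aestronglyMeasurable
  have hdom : ∀ᶠ p : ℝ × ℝ in 𝓝[>] 0 ×ˢ 𝓝[>] 0, ∀ᵐ r ∂(volume.restrict (Ioi 0)),
      ‖sphGreenKernel lam p.1 r * sphGreenKernel lam r p.2 * Real.sinh (2 * r)‖
        ≤ Φ ^ 2 * (sphDecay lam r * sphDecay lam r * Real.sinh (2 * r)) := by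
    filter_upwards [hsq] with p hp
    refine ae_restrict_of_forall_mem measurableSet_Ioi fun r hr => ?_
    have hr' : (0 : ℝ) < r := hr
    have h1 := abs_kernel_le_mul_sphDecay_of_le_one hlam hΦ hp.1 hp.2.1 hr'
    have h2 : |sphGreenKernel lam r p.2| ≤ Φ * sphDecay lam r := by
      rw [sphGreenKernel_symm]
      exact abs_kernel_le_mul_sphDecay_of_le_one hlam hΦ hp.2.2.1 hp.2.2.2 hr'
    have hsh : 0 ≤ Real.sinh (2 * r) := (sinh_two_mul_pos hr').le
    have hΦχ : 0 ≤ Φ * sphDecay lam r := mul_nonneg hΦ0.le (sphDecay_pos hlam hr').le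
    rw [Real.norm_eq_abs, abs_mul, abs_mul, abs_of_nonneg hsh]
    calc |sphGreenKernel lam p.1 r| * |sphGreenKernel lam r p.2| * Real.sinh (2 * r)
        ≤ (Φ * sphDecay lam r) * (Φ * sphDecay lam r) * Real.sinh (2 * r) :=
          mul_le_mul_of_nonneg_right (mul_le_mul h1 h2 (abs_nonneg _) hΦχ) hsh
      _ = Φ ^ 2 * (sphDecay lam r * sphDecay lam r * Real.sinh (2 * r)) := by ring
  have hlim : ∀ᵐ r ∂(volume.restrict (Ioi 0)), Tendsto
      (fun p : ℝ × ℝ => sphGreenKernel lam p.1 r * sphGreenKernel lam r p.2 * Real.sinh (2 * r))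
      (𝓝[>] 0 ×ˢ 𝓝[>] 0) (𝓝 (sphDecay lam r * sphDecay lam r * Real.sinh (2 * r))) := by
    refine ae_restrict_of_forall_mem measurableSet_Ioi fun r hr => ?_
    have hr' : (0 : ℝ) < r := hr
    have h1 : Tendsto (fun p : ℝ × ℝ => sphGreenKernel lam p.1 r) (𝓝[>] 0 ×ˢ 𝓝[>] 0) (𝓝 (-sphDecay lam r)) :=
      (tendsto_kernel_nhdsGT_zero lam hr').comp tendsto_fst
    have h2 : Tendsto (fun p : ℝ × ℝ => sphGreenKernel lam r p.2) (𝓝[>] 0 ×ˢ 𝓝[>] 0) (𝓝 (-sphDecay lam r)) := by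
      have := (tendsto_kernel_nhdsGT_zero lam hr').comp (tendsto_snd (f := 𝓝[>] (0 : ℝ)) (g := 𝓝[>] (0 : ℝ)))
      refine this.congr fun p => ?_
      simp only [Function.comp]
      exact sphGreenKernel_symm lam p.2 r
    have := (h1.mul h2).mul_const (Real.sinh (2 * r))
    simpa only [neg_mul_neg] using this
  exact tendsto_integral_filter_of_dominated_convergence _ hmeas hdom hbound hlim

end measure

end Summit.Ventures.HodgeRepro2.T5SU11KernelCompositionCorner
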